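import Summits.BirchSwinnertonDyer.BirchSwinnertonDyer.Theorems.TeichmullerTwistDescentKOfCarrier
import Literature.NumberTheory.ModularSymbols.FullLevelHomologyHeckeProjector
import Mathlib.RingTheory.Flat.TorsionFree
import HarnessLib

/-!
# Route `TeichmullerTwistDescent`, crux K `TwistedPeriodLatticeSaturation` (stmt-BirchSwinnertonDyer-25368):
# K, LITERALLY, from modularity + an integral Hecke quasi-projector for `f_E` + the tame-type carrier functional

Cell `pub/bsd-wall` (D-0145 line route-BirchSwinnertonDyer-TeichmullerTwistDescent, OPEN rev 7), seat `bsd-line-ttd-p1`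
(prover 1/2, g24).  THEOREMS ONLY (no definition, no named fact, no `sorry`).  BSD is not proved by this file; K is NOT
proved by this file: the main theorem is CONDITIONAL, with the route decl `TwistedPeriodLatticeSaturation` verbatim as its
conclusion.  Compared with `TeichmullerTwistDescentKOfCarrier.twistedPeriodLatticeSaturation_of_carrier`, the opaque
multiplicity-one hypothesis `hM1 : MultOneHyp …` is replaced by the standard Hecke-algebra statement

* `hproj` — for the newform `f = D.f` of a curve of conductor `p²M` (`p ∤ M`, `p ≥ 11`) there is `θ` in the `ℤ`-subalgebra of
  `End_{ℤ_p} H(p²M; ℤ_p)` generated by the `T_q`, `q ≠ p` prime, and `c ∈ ℤ ∖ {0}` with `θ(ker periodClassK f) = 0` and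
  `periodClassK f ∘ θ = c · periodClassK f` (an INTEGRAL HECKE QUASI-PROJECTOR onto the `f`-part: `θ = c·e_f`, which exists
  because the Hecke algebra `⊗ ℚ` is commutative semisimple on `H₁(X₀(p²M), ℚ)` and the `λ_f`-eigenspace of `{T_q}_{q ∤ pM}` is
  the `f`-part by strong multiplicity one),

via `Literature.…FullLevelHomologyHeckeProjector.multOneHyp_of_heckeProjector` (Hecke words lift `GL₂(ℤ/p)`-equivariantly to
the full-level carrier and intertwine the dictionary).  Also proved here: `smul_eq_zero_padicInt_tensor` (`ℤ_p ⊗ Λ_f` has no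
`ℤ`-torsion: flatness over the Dedekind domain `ℤ`), `multOneHyp_of_heckeProjector_padicInt`.

REMAINING INPUTS of the K-line after this file: `hproj` (Hecke algebra: semisimplicity + multiplicity one, cite-level), `hcar`
(the integral tame-type carrier functional — the load-bearing open input), `hnf` (modularity).
-/

set_option linter.dupNamespace false

noncomputable section

open scoped Pointwise MatrixGroups TensorProduct

open Function CongruenceSubgroup
open Literature.RepresentationTheory.FiniteGroups Literature.RepresentationTheory.FiniteGroups.GL2
  Literature.NumberTheory.EllipticCurves.ModularForms
open Literature.NumberTheory.EllipticCurves (Kato2004.teichmullerChar)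
open Literature.NumberTheory.ModularSymbols Literature.NumberTheory.ModularSymbols.FullLevel
open Literature.Algebra.Homology

namespace Summit.BirchSwinnertonDyer.BirchSwinnertonDyer.Theorems.TeichmullerTwistDescent.KOfHeckeProjector

open WeierstrassCurve Literature.NumberTheory.EllipticCurves
  Summit.BirchSwinnertonDyer.BirchSwinnertonDyer.Theorems.TeichmullerTwistDescent.CarrierKnapp
  Summit.BirchSwinnertonDyer.BirchSwinnertonDyer.Theorems.TeichmullerTwistDescent.CarrierMultOne
  Summit.BirchSwinnertonDyer.BirchSwinnertonDyer.Theorems.TeichmullerTwistDescent.KOfCarrier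

/-- **`ℤ_p ⊗_ℤ Λ` has no `ℤ`-torsion** for a lattice `Λ ⊂ ℂ` (`Λ` is torsion-free, hence flat over the Dedekind domain `ℤ`,
and so is `ℤ_p`; a nonzero integer is a non-zero-divisor on a flat `ℤ`-module). [cite: CremonaAlgorithms1997, §2.10] -/
theorem smul_eq_zero_padicInt_tensor (p : ℕ) [Fact p.Prime] (Λ : Submodule ℤ ℂ) {c : ℤ} (hc : c ≠ 0) (x : ℤ_[p] ⊗[ℤ] Λ)
    (h : (c : ℤ_[p]) • x = 0) : x = 0 := by
  rw [Int.cast_smul_eq_zsmul] at h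
  have hreg := Module.Flat.isSMulRegular_of_nonZeroDivisors (M := ℤ_[p] ⊗[ℤ] Λ) (mem_nonZeroDivisors_of_ne_zero hc)
  exact hreg (h.trans (smul_zero c).symm)

variable (p M : ℕ) [hp : Fact p.Prime] [NeZero M] [NeZero (p ^ 2 * M)] (hpM : Nat.Coprime p M)
  [Fintype (diagTorus (ZMod p))] [Invertible (Fintype.card (diagTorus (ZMod p)) : ℤ_[p])]

/-- **`MultOneHyp ℤ_p p M hpM f` from an integral Hecke quasi-projector** (`p ≥ 5`):
`Literature.…multOneHyp_of_heckeProjector` over `k = ℤ_p`, with `12 ∈ ℤ_pˣ` (`isUnit_twelve`) and the torsion-freeness of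
`ℤ_p ⊗ Λ_f` (`smul_eq_zero_padicInt_tensor`) supplied. [cite: AshStevens1986, §1 (1.3)–(1.4); Shimura1971, Thm. 3.41] -/
theorem multOneHyp_of_heckeProjector_padicInt (hp5 : 5 ≤ p) (f : CuspForm (Gamma0 (p ^ 2 * M)) 2)
    {θ : Module.End ℤ_[p] (CuspidalHomologyHeckeModule (p ^ 2 * M) ℤ_[p])} (hθ : θ ∈ Algebra.adjoin ℤ (heckeGenSet ℤ_[p] p M))
    {c : ℤ} (hc : c ≠ 0)
    (hkill : ∀ w : CuspidalHomologyHeckeModule (p ^ 2 * M) ℤ_[p], periodClassK (p ^ 2 * M) ℤ_[p] f w = 0 → θ w = 0)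
    (hscale : ∀ w : CuspidalHomologyHeckeModule (p ^ 2 * M) ℤ_[p],
      periodClassK (p ^ 2 * M) ℤ_[p] f (θ w) = (c : ℤ_[p]) • periodClassK (p ^ 2 * M) ℤ_[p] f w) :
    MultOneHyp ℤ_[p] p M hpM f := by
  haveI : Invertible (12 : ℤ_[p]) := (isUnit_twelve p hp5).invertible
  exact multOneHyp_of_heckeProjector ℤ_[p] p M hpM f hθ
    (fun x hx => smul_eq_zero_padicInt_tensor p _ hc x hx) hkill hscale

omit [NeZero M] [NeZero (p ^ 2 * M)] [Fintype (diagTorus (ZMod p))] [Invertible (Fintype.card (diagTorus (ZMod p)) : ℤ_[p])] hp in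
/-- **K from modularity, an integral Hecke quasi-projector for `f_E`, and the integral tame-type carrier functional.**  The
conclusion is the route decl `TwistedPeriodLatticeSaturation` VERBATIM; BSD is not proved by this, K only CONDITIONALLY on the
three hypotheses described in the module docstring.  Proof: as `KOfCarrier.twistedPeriodLatticeSaturation_of_carrier` (split
`N(W) = p²M`, `Fintype`/unit bookkeeping for `T̃(ℤ/p)`, residue field `ℤ/p`), with `MultOneHyp` supplied by
`multOneHyp_of_heckeProjector_padicInt`. [cite: EdixhovenManin1991, §4] [cite: AshStevens1986, §1 (1.2)–(1.4)]
[cite: EmertonGeeSavitt2015, Lemma 4.1.1] -/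
theorem twistedPeriodLatticeSaturation_of_heckeProjector (hnf : exists_isNewformOf)
    (hproj : ∀ (p M : ℕ) [Fact p.Prime] [NeZero M] [NeZero (p ^ 2 * M)] (_hpM : Nat.Coprime p M)
      (W : WeierstrassCurve ℚ) [W.IsElliptic] [W.IsGloballyMinimal], W.conductorNorm ℤ = p ^ 2 * M →
      ∀ D : ModularParametrizationData W (p ^ 2 * M), 11 ≤ p →
      ∃ (θ : Module.End ℤ_[p] (CuspidalHomologyHeckeModule (p ^ 2 * M) ℤ_[p])) (c : ℤ),
        θ ∈ Algebra.adjoin ℤ (heckeGenSet ℤ_[p] p M) ∧ c ≠ 0 ∧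
        (∀ w : CuspidalHomologyHeckeModule (p ^ 2 * M) ℤ_[p], periodClassK (p ^ 2 * M) ℤ_[p] D.f w = 0 → θ w = 0) ∧
        ∀ w : CuspidalHomologyHeckeModule (p ^ 2 * M) ℤ_[p],
          periodClassK (p ^ 2 * M) ℤ_[p] D.f (θ w) = (c : ℤ_[p]) • periodClassK (p ^ 2 * M) ℤ_[p] D.f w)
    (hcar : ∀ (p M : ℕ) [Fact p.Prime] [NeZero M] [NeZero (p ^ 2 * M)] (hpM : Nat.Coprime p M)
      [Fintype (diagTorus (ZMod p))] [Invertible (Fintype.card (diagTorus (ZMod p)) : ℤ_[p])]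
      (W : WeierstrassCurve ℚ) [W.IsElliptic] [W.IsGloballyMinimal], W.conductorNorm ℤ = p ^ 2 * M →
      ∀ D : ModularParametrizationData W (p ^ 2 * M), 11 ≤ p → Rank1Residual.Addv W p → Rank1Residual.Irr W p →
      Summit.BirchSwinnertonDyer.Rank1Residual.Additive.TypeGOrd W p → padicValInt p W.minimalDiscriminantInt ≤ 4 →
      ∃ (b m : ℕ) (Ψ : spreadLattice ℤ_[p] p M hpM D.f →ₗ[ℤ_[p]] (Option (ZMod p) → ℤ_[p])),
        0 < b ∧ 2 * b < p - 1 ∧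
        IsEquivariantOnSpread ℤ_[p] p M hpM D.f
          (coordRep (Kato2004.teichmullerChar p ^ (p - 1 - b)) (Kato2004.teichmullerChar p ^ b)) Ψ ∧
        (∀ v : Option (ZMod p) → ℤ_[p], (p : ℤ_[p]) ^ m • v ∈ LinearMap.range Ψ) ∧
        ∀ Λ' : Subrepresentation (coordRep (Kato2004.teichmullerChar p ^ (p - 1 - b)) (Kato2004.teichmullerChar p ^ b)),
          Λ'.toSubmodule = LinearMap.range Ψ →
            @ReductionSocleLe p _ (ZMod p) _ _ (PadicInt.toZMod (p := p)).toAlgebra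
              (Kato2004.teichmullerChar p ^ (p - 1 - b)) (Kato2004.teichmullerChar p ^ b) (2 * b) Λ') :
    Summit.BirchSwinnertonDyer.BirchSwinnertonDyer.Theses.TeichmullerTwistDescent.TwistedPeriodLatticeSaturation := by
  intro W _ _ p hp _ D hsq hp11 hadd hirr hGo hV4 hopt χ hχ hprim
  suffices aux : ∀ (N : ℕ) [NeZero N] (_hNN : W.conductorNorm ℤ = N) (D : ModularParametrizationData W N)
      (hsq : p ^ 2 ∣ N), (∀ z ∈ D.L.lattice, ∃ w ∈ periodLattice D.f, z = D.c * w) →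
      ∀ z ∈ periodLattice D.f, ∃ w ∈ periodLattice (charTwist N (dvd_refl _) hsq hχ D.f),
        z = gaussSum χ (ZMod.stdAddChar (N := p)) * w from aux _ rfl D hsq hopt
  intro N _ hNN D' hsq' hopt'
  obtain ⟨M, hM, hpM⟩ := conductorNorm_eq_sq_mul_coprime W p (by omega) (hNN ▸ hsq')
  obtain rfl : N = p ^ 2 * M := hNN.symm.trans hM
  haveI : NeZero M := ⟨fun h => NeZero.ne (p ^ 2 * M) (by rw [h, mul_zero])⟩
  haveI : Fintype (diagTorus (ZMod p)) := Fintype.ofFinite _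
  haveI : Invertible (Fintype.card (diagTorus (ZMod p)) : ℤ_[p]) := (isUnit_card_diagTorus p).invertible
  letI : Algebra ℤ_[p] (ZMod p) := (PadicInt.toZMod (p := p)).toAlgebra
  have hsurj : Surjective (algebraMap ℤ_[p] (ZMod p)) := ZMod.ringHom_surjective _
  have halg : ∀ x : ℤ_[p], algebraMap ℤ_[p] (ZMod p) x = ZMod.castHom (dvd_refl p) (ZMod p) (PadicInt.toZMod x) := fun x => by
    rw [ZMod.castHom_self, RingHom.id_apply]; rfl
  obtain ⟨b, m, Ψ, hb, hb2, hΨ, hm, hsoc⟩ := hcar p M hpM W hM D' hp11 hadd hirr hGo hV4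
  obtain ⟨θ, c, hθ, hc, hkill, hscale⟩ := hproj p M hpM W hM D' hp11
  exact saturation_at_of_carrier_of_multOne p M hpM hnf W hM D' hp11 hadd hirr hGo hV4 hopt' χ hχ hprim hsurj halg hb hb2 Ψ hΨ
    hm hsoc (multOneHyp_of_heckeProjector_padicInt p M hpM (by omega) D'.f hθ hc hkill hscale)

end Summit.BirchSwinnertonDyer.BirchSwinnertonDyer.Theorems.TeichmullerTwistDescent.KOfHeckeProjector
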